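import Summits.ValiantsHypothesis.ValiantsHypothesis.Theses.DivisionGap
import Summits.ValiantsHypothesis.ValiantsHypothesis.Theorems.DivisionGapDefs
import Summits.ValiantsHypothesis.ValiantsHypothesis.Theorems.DivisionGapPerDivisionHardStubFaceDescent
import Summits.ValiantsHypothesis.ValiantsHypothesis.Theorems.DivisionGapPerDivisionHardStubJssContraction
import Summits.ValiantsHypothesis.ValiantsHypothesis.Theorems.DivisionGapPerDivisionHardStubBlockArsenal
import Summits.ValiantsHypothesis.ValiantsHypothesis.Theorems.DivisionGapPerDivisionHardStubAtomicTorus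
import Summits.ValiantsHypothesis.ValiantsHypothesis.Theorems.DivisionGapPerDivisionHardStubAtomicRigid

/-!
# Crux `DivisionGap.PerDivisionHard` (stmt-ValiantsHypothesis-5065) — the ATOMIC RUNG, unconditionally

`PerDivisionHard` asks, for every `c` and all large `n`, that every nonzero cofactor
`h ∈ ℝ≥0[x_ij]` satisfies `2^{(log₂ n + c)^c} < L(per_n · h) + L(h)` (monotone fan-in-two
`complexity` over `ℝ≥0`).  This file proves it for every ATOMIC EXPRESSION
`h = Σ_{l ∈ L} a_l · x^{C_l} · ∏_{β ∈ I} F_β^{μ_l(β)}` — finitely many terms, each a monomial times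
a product of powers of shared atoms `F_β` (arbitrary nonzero polynomials) — with at most
`2^{n/(log₂ n + e)^e}` terms, `Σ_β |supp F_β|² ≤ 2^{n/(log₂ n + e)^e}`, and pairwise ATOMIC
DISTANCE `∏_{β : μ_l(β) ≠ μ_{l'}(β)} |supp F_β| ≤ 2^{n/(log₂ n + e)^e}` (`e = e(c)`), of arbitrary
degrees, multiplicities and cost:

* `perDivisionHard_atomic`.

It is the composition `perDivisionHard_atomic_of` of skeleton v7.1 of line
`pair-descent-jss-endpoint` (`Cruxes/PerDivisionHard/Lines/pair_descent_jss_endpoint.lean`) with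
every stub a landed theorem: the torus normal form of an atomic expression is atomic
(`stub_atomicTorus`) → a placement of the subdivided block `G(b,k) ⊕ M₀` with long subdivision
paths avoiding the row sets of internal pairs and cross patterns, on which the top fibre of the
generic cut is a single monomial (`stub_atomicRigid`, using `stub_atomicTop`) → face descent
(`stub_faceDescent`) → Jukna–Seiwert–Sergeev contraction (`stub_jssContraction`) → hardness of the
placed face (`stub_blockArsenal`).  This is the first rung of the line with ADDITIVE structure
across frames; it contains the sparse-product rung (`Theorems/DivisionGapPerDivisionHardSparseProduct.lean`,
one term) with the support bound raised from `2^{(log₂ n + c)^c}` to `2^{n/(log₂ n + e)^e}`, sums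
`W · (F₁ + ⋯ + F_r)`, `Σ_l ∏_{β ∈ T_l} F_β` with small symmetric differences `T_l ∆ T_{l'}`, and every
sparse polynomial expression `Q(F_1, …, F_A)` in `A ≤ n / (polylog · log S)` atoms of support `≤ S`.
-/

noncomputable section

-- `Summit.ValiantsHypothesis.ValiantsHypothesis.…` is the tree's mandated single-conjunct layout
-- (Sub = Summit), so the duplicated namespace component is intended.
set_option linter.dupNamespace false

namespace Summit.ValiantsHypothesis.ValiantsHypothesis.Theorems.DivisionGapPerDivisionHard

open MvPolynomial Literature.Computability.AlgebraicComplexity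
open scoped NNReal

/-- **The atomic rung of `PerDivisionHard`.**  For every `c` there are `e, n₀` such that for all
`n ≥ n₀` and every atomic expression `Σ_{l ∈ L} a_l · x^{C_l} · ∏_{β ∈ I} F_β^{μ_l(β)}` with nonzero
atoms, nonzero value, at most `2^{n/(log₂ n+e)^e}` terms, `Σ_β |supp F_β|² ≤ 2^{n/(log₂ n+e)^e}` and
pairwise atomic distance `∏_{β : μ_l β ≠ μ_{l'} β} |supp F_β| ≤ 2^{n/(log₂ n+e)^e}`, the pair
inequality `2^{(log₂ n + c)^c} < L(per_n · h) + L(h)` holds — any degrees, multiplicities, cost.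
Composition of the landed stubs of line `pair-descent-jss-endpoint`. [folklore] -/
theorem perDivisionHard_atomic :
    ∀ c : ℕ, ∃ e n₀ : ℕ, ∀ n ≥ n₀, ∀ (ι κ : Type) (I : Finset ι) (L : Finset κ)
      (F : ι → MvPolynomial (Fin n × Fin n) ℝ≥0) (a : κ → ℝ≥0) (C : κ → (Fin n × Fin n) →₀ ℕ)
      (μ : κ → ι → ℕ),
      (∀ β ∈ I, F β ≠ 0) →
      (∑ l ∈ L, a l • (monomial (C l) (1 : ℝ≥0) * ∏ β ∈ I, F β ^ μ l β)) ≠ 0 →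
      L.card ≤ 2 ^ (n / (Nat.log 2 n + e) ^ e) →
      (∑ β ∈ I, (F β).support.card ^ 2) ≤ 2 ^ (n / (Nat.log 2 n + e) ^ e) →
      (∀ l ∈ L, ∀ l' ∈ L, l ≠ l' →
        ∏ β ∈ I.filter (fun β => μ l β ≠ μ l' β), (F β).support.card ≤
          2 ^ (n / (Nat.log 2 n + e) ^ e)) →
      2 ^ ((Nat.log 2 n + c) ^ c) <
        complexity (perPoly (Fin n) ℝ≥0 *
            ∑ l ∈ L, a l • (monomial (C l) (1 : ℝ≥0) * ∏ β ∈ I, F β ^ μ l β)) +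
          complexity (∑ l ∈ L, a l • (monomial (C l) (1 : ℝ≥0) * ∏ β ∈ I, F β ^ μ l β)) := by
  classical
  intro c
  obtain ⟨κ₀, hcon⟩ := stub_jssContraction
  obtain ⟨d, n₁, hhard⟩ := stub_blockArsenal c κ₀
  obtain ⟨e, n₀, hR⟩ := stub_atomicRigid d
  refine ⟨e, n₀ + n₁, ?_⟩
  intro n hn ι κ I L F a C μ hF hh hL hI hpair
  obtain ⟨L', F', hL'L, hF', hF'tor, hF'supp, hh', htor, hle1, hle2⟩ :=
    stub_atomicTorus n ι κ I L F a C μ hF hh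
  by_contra hlt
  have hle : complexity (perPoly (Fin n) ℝ≥0 *
        ∑ l ∈ L, a l • (monomial (C l) (1 : ℝ≥0) * ∏ β ∈ I, F β ^ μ l β)) +
      complexity (∑ l ∈ L, a l • (monomial (C l) (1 : ℝ≥0) * ∏ β ∈ I, F β ^ μ l β)) ≤
      2 ^ ((Nat.log 2 n + c) ^ c) := not_lt.mp hlt
  -- the count bounds transfer to the normal form
  have hL' : L'.card ≤ 2 ^ (n / (Nat.log 2 n + e) ^ e) := le_trans (Finset.card_le_card hL'L) hL
  have hI' : (∑ β ∈ I, (F' β).support.card ^ 2) ≤ 2 ^ (n / (Nat.log 2 n + e) ^ e) :=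
    le_trans (Finset.sum_le_sum fun β hβ =>
      Nat.pow_le_pow_left (Finset.card_le_card (hF'supp β hβ)) 2) hI
  have hpair' : ∀ l ∈ L', ∀ l' ∈ L', l ≠ l' →
      ∏ β ∈ I.filter (fun β => μ l β ≠ μ l' β), (F' β).support.card ≤
        2 ^ (n / (Nat.log 2 n + e) ^ e) := by
    intro l hl l' hl' hll'
    refine le_trans (Finset.prod_le_prod' fun β hβ => ?_) (hpair l (hL'L hl) l' (hL'L hl') hll')
    exact Finset.card_le_card (hF'supp β (Finset.mem_filter.mp hβ).1)
  obtain ⟨b, k, m, eR, eC, w, u, hb, hcut, hsingle⟩ :=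
    hR n (by omega) ι κ I L' F' a C μ hF' hF'tor hh' htor hL' hI' hpair'
  set h' := ∑ l ∈ L', a l • (monomial (C l) (1 : ℝ≥0) * ∏ β ∈ I, F' β ^ μ l β) with hh'def
  have hdesc := stub_faceDescent n (placedBlock eR eC) w h' u hcut hh' hsingle
  have h1 : complexity (monomial u (1 : ℝ≥0) * facePer (placedBlock eR eC)) ≤
      2 ^ ((Nat.log 2 n + c) ^ c) + 1 :=
    calc complexity (monomial u (1 : ℝ≥0) * facePer (placedBlock eR eC))
        ≤ complexity (perPoly (Fin n) ℝ≥0 * h') + 1 := hdesc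
      _ ≤ complexity (perPoly (Fin n) ℝ≥0 *
            ∑ l ∈ L, a l • (monomial (C l) (1 : ℝ≥0) * ∏ β ∈ I, F β ^ μ l β)) + 1 :=
          Nat.add_le_add_right hle1 1
      _ ≤ 2 ^ ((Nat.log 2 n + c) ^ c) + 1 :=
          Nat.add_le_add_right (le_trans (Nat.le_add_right _ _) hle) 1
  have h2 : complexity (facePer (placedBlock eR eC)) ≤
      ((n + 2) * (2 ^ ((Nat.log 2 n + c) ^ c) + 3)) ^ κ₀ :=
    calc complexity (facePer (placedBlock eR eC))
        ≤ ((n + 2) * (complexity (monomial u (1 : ℝ≥0) * facePer (placedBlock eR eC)) + 2)) ^ κ₀ :=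
          hcon n (facePer (placedBlock eR eC)) u
      _ ≤ ((n + 2) * (2 ^ ((Nat.log 2 n + c) ^ c) + 3)) ^ κ₀ :=
          Nat.pow_le_pow_left (Nat.mul_le_mul_left _ (by omega)) κ₀
  have h3 := hhard n (by omega) b k m eR eC hb
  exact absurd (lt_of_lt_of_le h3 h2) (lt_irrefl _)

end Summit.ValiantsHypothesis.ValiantsHypothesis.Theorems.DivisionGapPerDivisionHard

end
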